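import Literature.NumberTheory.EllipticCurves.BurungaleSkinnerTianWan2024.GreenbergMainStatementOPEN
import Literature.NumberTheory.EllipticCurves.YanZhu2026.GreenbergDivisibilityAwayFromCycProofs
import Literature.NumberTheory.Automorphic.BCDTModularity
import Literature.NumberTheory.Automorphic.ThorneQInfinityModularTheorem2Proofs
import HarnessLib

/-!
# Burungale–Skinner–Tian–Wan Thm. 9.24 (GMC_r), first clause, for an elliptic curve at a good
# ORDINARY prime: the OPEN binder's conclusion is a THEOREM below two REFEREED Yan–Zhu 2026 facts
# (on the Yan–Zhu locus `D_L` odd, `D_L ≠ −3`) — PROOFS ONLY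

Paper of record: A. Burungale, C. Skinner, Y. Tian, X. Wan, *Zeta elements for elliptic curves and
applications*, arXiv:2409.01350v2 — an UNREFEREED PREPRINT. Typed ≠ proved ≠ endorsed. This file
introduces NO named fact and NO definition (typer seat `bsd-littype-01`, gen 5; companion of gen 4's
`GreenbergMainStatementOPEN`). It answers, in the kernel, the pricing question «how much of Thm. 9.24 is
already refereed print?» raised for the K3 cells (two-variable main-conjecture cluster) and handed to
this seat by `bsd-littype-04` (HOME/INBOX 2026-08-27T02:51:46Z).

WHAT IS PROVED. `exists_cyc_mul_charIdealXGr₂_le_of_goodOrd_of_yanZhu`: take the hypothesis list of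
the OPEN binder `thm924_greenberg_dvd_charIdealXGr₂_awayFromCyc_OPEN` (BSTW Thm. 9.24, first clause,
`E`-instance: `N = N_E`, `p ≠ 2`, `L = K` imaginary quadratic with (ord) `p = v v̄`, `v` induced by
`ι`, `(N, D_K) = 1`, (irr_L) as absolute irreducibility of every `𝔽_p`-framing of `E[p]|_{G_K}`,
`(κ₁, κ₂)` = (cyclotomic, anticyclotomic) with generator pair `(γ₁, γ₂)`, a Katz frame `LK`, a
reduction-type-free Greenberg frame `G` at the inverse generators and a structure-compatible `J`),
DROP «`N` square-free», «`p ∤ N`» and (spl) (not needed), ADD «`p` good ORDINARY» and Yan–Zhu's (disc)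
«`D_K` odd, `D_K ≠ −3`», and grant — instead of the preprint — the two REFEREED Yan–Zhu 2026 facts
`YanZhu2026.thm47_ord_localised_iff_greenbergAnyRoot_localised` (J. Algebra 693, Thm. 4.7: the
Beilinson–Flach equivalence; cell flag `YZ26@3-BF-ERL-Ohta` at `p = 3`) and
`YanZhu2026.cor46_XOrd₂_charIdeal_le_perrinRiou_awayFromPlus` (Cor. 4.6: Hida theory + Skinner–Urban)
together with modularity-with-parametrisation (`nonempty_modularParametrizationData`, the datum the
Yan–Zhu facts are stated over). CONCLUSION: LITERALLY the binder's — a non-zero cyclotomic-variable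
series `s ∈ 𝒪_{ℂ_p}⟦T₁⟧` with `s · char(X_Gr(E/L_∞))𝒪_{ℂ_p}⟦T₁,T₂⟧ ⊆ (G)`. The work is the tree theorem
`YanZhu2026.exists_cyc_mul_charIdealXGr₂_le_of_thm47AnyRoot_of_cor46` (littype-04, Yan–Zhu's proof of
Thm. 4.2 (2), first display, arXiv v4 l.1038–1041); this file supplies the glue between the two
hypothesis languages: the embedding `ι₁ : ℤ̄ → ℂ_p` compatible with `ι` is CONSTRUCTED inline
(restrict `ι⁻¹` to `ℤ̄ ⊂ ℂ`, then complete `PadicAlgCl p → ℂ_p`); (irr_L) in the binder's framed form gives `E[p]|_{G_K}` irreducible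
(`hasIrreducibleModPGaloisRep_of_forall_isAbsolutelyIrreducible`, via the tree's
`exists_isTorsionGaloisRep` and `hasIrreducibleModPGaloisRep_of_isIrreducible`); the newform `f` of the
binder equals the parametrisation datum's newform (`IsNewformOf.unique`, multiplicity one at level `N_E`).

CONSEQUENCE FOR PRICING (OPEN-QUESTIONS-01 §H): at a good ORDINARY `p` and on the locus `D_L` odd,
`D_L ≠ −3`, the first clause of BSTW Thm. 9.24 for `g = f_E` carries NO preprint content beyond the two
refereed Yan–Zhu statements (indeed WITHOUT «`N` square-free» and WITHOUT (spl)); the preprint content of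
Thm. 9.24 is (i) the SUPERSINGULAR case, (ii) even `D_L` / `D_L = −3`, (iii) the twist clause
(`thm924_twist_…_OPEN`, OPEN-QUESTIONS-01 Q17). Nothing is asserted about the binders.

## References
* [BurungaleSkinnerTianWan2024] arXiv:2409.01350v2: Thm. 9.24 (pp. 85–86; label GMC_r, tex l.7258–7269).
* [YanZhu2024MainConjNonCM] X. Yan, X. Zhu, J. Algebra 693 (2026) = arXiv:2412.20078v4: Thm. 4.7
  (l.1022–1034), Cor. 4.6 (l.996–1003), proof of Thm. 4.2 (2) first display (l.1038–1041).
* [BCDTJAMS2001] Breuil–Conrad–Diamond–Taylor, Thm. A (modularity; `nonempty_modularParametrizationData`).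
-/

noncomputable section

open scoped Classical

open PowerSeries NumberField IsDedekindDomain Field CongruenceSubgroup
  Literature.NumberTheory.GaloisRepresentations Literature.NumberTheory.EllipticCurves
  Literature.NumberTheory.EllipticCurves.ModularForms Literature.NumberTheory.EllipticCurves.Rank1Residual

namespace Literature.NumberTheory.EllipticCurves.BurungaleSkinnerTianWan2024

open IwasawaAlgebra₂

/-! ### §0. Glue between the binder's hypothesis language and Yan–Zhu's -/

/-- **(irr_L) in framed form gives irreducibility of `E[p]|_{G_K}`.** If every `𝔽_p`-framing of the
`p`-torsion representation of `E/K` is absolutely irreducible (the binder's spelling of BSTW's (irr_L),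
Yan–Zhu's spelling of (irr_K)), then `E[p]` is an irreducible `Γ_K`-module
(`WeierstrassCurve.HasIrreducibleModPGaloisRep`): a framing exists (`exists_isTorsionGaloisRep`,
`#E[p] = p²`), absolute irreducibility implies irreducibility, and an invariant line of `E[p]` would be
an invariant line of the framing (`Thorne2016.hasIrreducibleModPGaloisRep_of_isIrreducible`). [folklore]
[cite: SilvermanAEC2009, III.§7 (the representation on E[m])] -/
theorem hasIrreducibleModPGaloisRep_of_forall_isAbsolutelyIrreducible {F : Type} [Field F]
    [NumberField F] (W : WeierstrassCurve F) [W.IsElliptic] (p : ℕ) [Fact p.Prime]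
    (hirr : ∀ ρ : ModPGaloisRep F (ZMod p) 2, W.IsTorsionGaloisRep p ρ →
      FramedRep.IsAbsolutelyIrreducible ρ) :
    W.HasIrreducibleModPGaloisRep p := by
  haveI : NeZero ((p : ℕ) : F) := NeZero.charZero
  obtain ⟨ρ, hρ⟩ := W.exists_isTorsionGaloisRep p
  exact Literature.NumberTheory.Automorphic.Thorne2016.hasIrreducibleModPGaloisRep_of_isIrreducible hρ
    (hirr ρ hρ).isIrreducible

/-! ### §1. Thm. 9.24, first clause, at a good ORDINARY prime on the Yan–Zhu locus — PROVED below two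
REFEREED Yan–Zhu facts + modularity -/

/-- **BSTW Thm. 9.24 (GMC_r), first clause, `E`-instance, at a good ORDINARY prime `p` with `D_L` odd,
`D_L ≠ −3` — the OPEN binder's conclusion as a THEOREM below the REFEREED Yan–Zhu 2026 Thm. 4.7 and
Cor. 4.6 and modularity-with-parametrisation.** Hypotheses, in the binder's vocabulary and order
(`thm924_greenberg_dvd_charIdealXGr₂_awayFromCyc_OPEN`): `W` globally minimal with newform `f` at level
`N = N_E`; `p ≠ 2`; `K` imaginary quadratic, `p = v v̄` split, `v ≠ v̄` over `p`, `v` induced by `ι`;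
`(N, D_K) = 1`; (irr_L) framed; `κ₁` cyclotomic, `κ₂` anticyclotomic; a Katz frame `LK`, a
reduction-type-free Greenberg frame `G` at `(γ₁⁻¹, γ₂⁻¹)`, a structure-compatible `J` — WITHOUT the
binder's «`N` square-free», «`p ∤ N`», (spl); WITH, in addition, `GoodOrd W p` (good ordinary),
`Odd D_K`, `D_K ≠ −3` (Yan–Zhu's (disc)). Granted `h47`, `h46` (REFEREED, J. Algebra 693) and `hmod`
(`nonempty_modularParametrizationData`): `∃ s ∈ 𝒪_{ℂ_p}⟦T₁⟧ ∖ 0`,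
`s · char_{𝒪_{ℂ_p}⟦T₁,T₂⟧}(X_Gr(E/K_∞)) ⊆ (G)` — verbatim the binder's conclusion. Proof: Yan–Zhu's first
display of the proof of Thm. 4.2 (2) (tree theorem
`YanZhu2026.exists_cyc_mul_charIdealXGr₂_le_of_thm47AnyRoot_of_cor46`) over `GreenbergSetting`, with
`ι₁ := ι⁻¹|_{ℤ̄}` completed, (irr_K) from `hasIrreducibleModPGaloisRep_of_forall_isAbsolutelyIrreducible`
and `f = π.f` by multiplicity one (`IsNewformOf.unique`). So at ordinary `p` on this locus the first
clause of Thm. 9.24 has no preprint content; the binder remains the only source at SUPERSINGULAR `p`, for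
even `D_K` or `D_K = −3`, and for the twist clause.
[cite: YanZhu2024MainConjNonCM, Thm. 4.7 (arXiv:2412.20078v4 l.1022–1034), Cor. 4.6 (l.996–1003) and proof of Thm. 4.2 (2), first display (l.1038–1041)]
[cite: BurungaleSkinnerTianWan2024, Thm. 9.24 first clause (pp. 85–86; label GMC_r, tex l.7258–7269) (shape of the conclusion; OPEN binder not used)] -/
theorem exists_cyc_mul_charIdealXGr₂_le_of_goodOrd_of_yanZhu
    (h47 : YanZhu2026.thm47_ord_localised_iff_greenbergAnyRoot_localised)
    (h46 : YanZhu2026.cor46_XOrd₂_charIdeal_le_perrinRiou_awayFromPlus)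
    (hmod : nonempty_modularParametrizationData)
    {p : ℕ} [Fact p.Prime] (ι : PadicAlgCl p ≃+* ℂ) (W : WeierstrassCurve ℚ) [W.IsElliptic]
    [W.IsGloballyMinimal] (K : Type) [Field K] [NumberField K] (v vbar : HeightOneSpectrum (𝓞 K))
    (κ₁ κ₂ : ZpExtension K p) (γ₁ γ₂ : absoluteGaloisGroup K)
    [Fact (ZpExtension.IsTopGeneratorPair κ₁ κ₂ γ₁ γ₂)] {N : ℕ} [NeZero N] {f : CuspForm (Gamma0 N) 2}
    (hf : IsNewformOf W f) [NeZero (NumberField.discr K).natAbs]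
    -- `g = f_E` of level `N = N_E`, `p ≠ 2` good ORDINARY
    (hN : (N : ℤ) = W.conductorNorm ℤ) (hp2 : p ≠ 2) (hGO : GoodOrd W p)
    -- `L = K` imaginary quadratic; (ord) `p = v v̄`, `v` induced by `ι`; `(N, D_K) = 1`; (disc)
    (hK : IsImaginaryQuadratic K) (hsplit : ((Ideal.span {(p : ℤ)}).primesOver (𝓞 K)).ncard = 2)
    (hv : ((p : ℕ) : 𝓞 K) ∈ v.asIdeal) (hvbar : ((p : ℕ) : 𝓞 K) ∈ vbar.asIdeal) (hne : vbar ≠ v)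
    (hcompat : ∀ (w : InfinitePlace K) (k : 𝓞 K), k ∈ v.asIdeal ↔ ‖ι.symm (w.embedding (k : K))‖ < 1)
    (hcop : IsCoprime (N : ℤ) (NumberField.discr K)) (hodd : Odd (NumberField.discr K))
    (hne3 : NumberField.discr K ≠ -3)
    -- (irr_L), framed
    (hirr : ∀ ρ : ModPGaloisRep K (ZMod p) 2, (W.baseChange K).IsTorsionGaloisRep p ρ →
      FramedRep.IsAbsolutelyIrreducible ρ)
    -- the `ℤ_p²`-tower
    (hκ₁ : κ₁.IsCyclotomic) (hκ₂ : κ₂.IsAnticyclotomic)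
    -- a Katz frame and a reduction-type-free Greenberg frame at the inverse generators
    {Ω δ : ℂ} {Ωp : (unrIntegers p)ˣ} {LK G : PowerSeries (PowerSeries (PadicComplexInt p))}
    (hLK : IsKatzMeasure₂ ι v vbar ∅ κ₁ κ₂ γ₁⁻¹ γ₂⁻¹ 1 Ω δ ((Ωp : unrIntegers p) : ℂ_[p]) LK)
    (hG : IsGreenbergLFunctionAnyRoot₂ ι v vbar κ₁ κ₂ γ₁⁻¹ γ₂⁻¹ f (NumberField.discr K).natAbs
      (NumberField.classNumber K) LK G)
    (J : ℤ_[p] →+* PadicComplexInt p)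
    (hJ : ∀ x : ℤ_[p], ((J x : PadicComplexInt p) : ℂ_[p]) = ((x : ℚ_[p]) : ℂ_[p])) :
    ∃ s : PowerSeries (PadicComplexInt p), s ≠ 0 ∧
      Ideal.span {PowerSeries.map (PowerSeries.C (R := PadicComplexInt p)) s} *
          (WeierstrassCurve.XGr₂.charIdeal (W.baseChange K) p κ₁ κ₂ vbar γ₁ γ₂).map (toUnr₂ p J) ≤
        Ideal.span {G} := by
  -- the level is `N_E`: transport the modular parametrisation datum
  obtain rfl : N = W.conductorNorm ℤ := by exact_mod_cast hN
  obtain ⟨π⟩ := hmod W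
  -- multiplicity one: the binder's newform is the datum's newform
  obtain rfl : f = π.f := hf.unique π.isNewformOf
  -- `p > 2`
  have h3 : 3 ≤ p := by
    have h2 := (Fact.out : p.Prime).two_le
    omega
  -- Yan–Zhu's standing data
  have hset : YanZhu2026.GreenbergSetting ι W (W.conductorNorm ℤ) K v vbar κ₁ κ₂ :=
    { level := rfl
      three_le := h3
      goodOrd := hGO
      isImaginaryQuadratic := hK
      split := hsplit
      mem_v := hv
      mem_vbar := hvbar
      vbar_ne := hne
      compat := hcompat
      coprime := hcop
      discr_odd := hodd
      discr_ne := hne3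
      cyclotomic := hκ₁
      anticyclotomic := hκ₂ }
  haveI : (W.baseChange K).IsElliptic := by rw [WeierstrassCurve.baseChange]; infer_instance
  -- the embedding `ι₁ : ℤ̄ → ℂ_p` compatible with `ι`: restrict `ι⁻¹` and complete
  exact YanZhu2026.exists_cyc_mul_charIdealXGr₂_le_of_thm47AnyRoot_of_cor46 h47 h46
    ((algebraMap (PadicAlgCl p) ℂ_[p]).comp
      (ι.symm.toRingHom.comp (integralClosure ℚ ℂ).val.toRingHom)) ι W K v vbar κ₁ κ₂ γ₁ γ₂ π hset
    (hasIrreducibleModPGaloisRep_of_forall_isAbsolutelyIrreducible (W.baseChange K) p hirr)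
    (fun _ ↦ rfl) hLK hG J hJ

end Literature.NumberTheory.EllipticCurves.BurungaleSkinnerTianWan2024

end
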